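import Summits.CriticalPhenomena.PercolationContinuityZ3.Theorems.PercNearOneGluingNoHeavyLowerTailSahiTriangleClassT
import Summits.CriticalPhenomena.PercolationContinuityZ3.Theorems.SahiMasterFamilySupport
import Literature.Combinatorics.Sahi2008.PushForward
import Mathlib.Tactic.Linarith
import Mathlib.Tactic.Ring
import HarnessLib

/-!
# `NoHeavyLowerTail` (crux stmt-CriticalPhenomena-4575), P2 — **CLASS T ON A SINGLE CUBE**: Sahi's `C_3` / Kahn's Conjecture 5 for every
# triple of increasing EVENTS `U₀, U₁, U₂ ⊆ 2^κ` with no coordinate essential to all three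

Support file (seat `prim-masterthm-p2`, gen 14; `--supports stmt-CriticalPhenomena-4575`).  No `sorry`, standard axioms.  Two small definitions
(`glue3`, `traces`: gluing a configuration of `κ` from its traces on three blocks).

WHY.  P2's class-T theorems are stated on a product of THREE blocks `α × β × 2^C` (`SahiTriangleClassT.sahiE_three_nonneg_cubes_triangle`, gen 8:
`E_3 ≥ 0` for monotone `f(c,a), g(c,b), h(a,b)`; `SahiClassTLambdaTwo.sq_mul_sahiE_three_add_le_cubes`, gen 14: the λ = 2 rung), while the rest of the
programme (master-conj's BGC reductions, P4's face-vanishing / terminal analysis, bnk-2's two-level laws, P3/P5's comb files with `SahiHybrid.IsClassT`)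
works with events `U : Fin 3 → Set (Set κ)` on ONE cube and the product weight `bernoulliWeight p`.  This file is the bridge (gen-8 HANDOFF item (2)).

* `glue3 blk` — for a block labelling `blk : κ → Fin 3` (block `0` = the coordinates shared by `U₀,U₁`; `1` = by `U₀,U₂`; `2` = by `U₁,U₂`), the
  configuration of `κ` glued from configurations of the three blocks; `mem_glue3_*`, `traces`, `glue3_traces`, `traces_glue3`, `glue3_injective`,
  `glue3_mono`; **`weight_glue3` / `pushWeight_glue3`**: the product weight is the push-forward along `glue3` of the product of the three block
  weights; `ind_glue3_of_determinedBy_ne_*`: an event unaffected by one block pulls back to a function of the other two.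
* `sahiE_three_ind_eq_blocks` — `E_3(μ_p; 1_{U₀},1_{U₁},1_{U₂})` IS the three-block `E_3` of the pulled-back functions (`sahiE_pushWeight`).
* **`sahiE_three_nonneg_of_blocks`** — `E_3(μ_p; 1_U) ≥ 0` whenever `U₀` is unaffected by block `2`, `U₁` by block `1`, `U₂` by block `0`.
* **`sahiE_three_nonneg_of_classT`** (and the `Fin 3`-family form `sahiE_three_nonneg_of_classT'`) — **for increasing `U₀, U₁, U₂ ⊆ 2^κ` with
  `∀ x, ¬(x ∈ esupp U₀ ∧ x ∈ esupp U₁ ∧ x ∈ esupp U₂)` (= `SahiHybrid.IsClassT fun i => esupp (U i)`, definitionally) and EVERY `p`,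
  `0 ≤ E_3(bernoulliWeight p; 1_{U₀}, 1_{U₁}, 1_{U₂})`** — Kahn's Conjecture 5 on the whole class T, in the tree's single-cube vocabulary
  (blocks `C = esupp U₀ ∩ esupp U₁`, `A = esupp U₀ ∖ esupp U₁`, `B = (esupp U₀)ᶜ`).
CONSEQUENCE FOR THE FRONTIER (with master-conj's reductions and `…SahiCoordinateCanalyzingPeel`): the open core of Kahn's `C_3` on cubes consists of
mixed-core triples having at least one coordinate essential to all three members.  The λ = 2 / BGC single-cube statements follow in the companion
file `…SahiClassTSingleCubeLambdaTwo`.  HONEST FRAMING: `C_3` off class T remains OPEN. [this work]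
-/

noncomputable section

open scoped Classical

namespace Summit.CriticalPhenomena.PercolationContinuityZ3.Theorems

namespace SahiClassTCube

open Finset Function
open Literature.Combinatorics.Sahi2008
open Literature.Probability.Percolation (DeterminedBy determinedBy_iff)
open Literature.Probability.Percolation.BHK2006 (weight weight_nonneg weight_inter_mul_union)
open Literature.Probability.Percolation.DecisionTree (ind ind_of_mem ind_of_not_mem ind_nonneg)

variable {κ : Type} [Fintype κ]

/-! ### Gluing three block-configurations -/

/-- The configuration of `κ` glued from configurations of the three blocks of a labelling `blk : κ → Fin 3`
(block `1` = the `f`–`h` block `A`, block `2` = the `g`–`h` block `B`, block `0` = the `f`–`g` block `C`; the triple is ordered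
`(a, b, c)` as in `SahiTriangleClassT.sahiE_three_nonneg_cubes_triangle`). [this work] -/
def glue3 (blk : κ → Fin 3) (q : Set {x // blk x = 1} × Set {x // blk x = 2} × Set {x // blk x = 0}) : Set κ :=
  {x | (∃ h : blk x = 1, (⟨x, h⟩ : {x // blk x = 1}) ∈ q.1) ∨ (∃ h : blk x = 2, (⟨x, h⟩ : {x // blk x = 2}) ∈ q.2.1) ∨
    (∃ h : blk x = 0, (⟨x, h⟩ : {x // blk x = 0}) ∈ q.2.2)}

variable (blk : κ → Fin 3)

omit [Fintype κ] in
/-- Membership of a block-`1` coordinate in a glued configuration. [this work] -/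
theorem mem_glue3_one (q : Set {x // blk x = 1} × Set {x // blk x = 2} × Set {x // blk x = 0}) {x : κ} (hx : blk x = 1) :
    x ∈ glue3 blk q ↔ (⟨x, hx⟩ : {x // blk x = 1}) ∈ q.1 := by
  simp only [glue3, Set.mem_setOf_eq]
  constructor
  · rintro (⟨h, hm⟩ | ⟨h, _⟩ | ⟨h, _⟩)
    · exact hm
    · exact absurd (hx.symm.trans h) (by decide)
    · exact absurd (hx.symm.trans h) (by decide)
  · exact fun hm => Or.inl ⟨hx, hm⟩

omit [Fintype κ] in
/-- Membership of a block-`2` coordinate in a glued configuration. [this work] -/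
theorem mem_glue3_two (q : Set {x // blk x = 1} × Set {x // blk x = 2} × Set {x // blk x = 0}) {x : κ} (hx : blk x = 2) :
    x ∈ glue3 blk q ↔ (⟨x, hx⟩ : {x // blk x = 2}) ∈ q.2.1 := by
  simp only [glue3, Set.mem_setOf_eq]
  constructor
  · rintro (⟨h, _⟩ | ⟨h, hm⟩ | ⟨h, _⟩)
    · exact absurd (hx.symm.trans h) (by decide)
    · exact hm
    · exact absurd (hx.symm.trans h) (by decide)
  · exact fun hm => Or.inr (Or.inl ⟨hx, hm⟩)

omit [Fintype κ] in
/-- Membership of a block-`0` coordinate in a glued configuration. [this work] -/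
theorem mem_glue3_zero (q : Set {x // blk x = 1} × Set {x // blk x = 2} × Set {x // blk x = 0}) {x : κ} (hx : blk x = 0) :
    x ∈ glue3 blk q ↔ (⟨x, hx⟩ : {x // blk x = 0}) ∈ q.2.2 := by
  simp only [glue3, Set.mem_setOf_eq]
  constructor
  · rintro (⟨h, _⟩ | ⟨h, _⟩ | ⟨h, hm⟩)
    · exact absurd (hx.symm.trans h) (by decide)
    · exact absurd (hx.symm.trans h) (by decide)
    · exact hm
  · exact fun hm => Or.inr (Or.inr ⟨hx, hm⟩)

/-- The three block-traces of a configuration. [this work] -/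
def traces (ω : Set κ) : Set {x // blk x = 1} × Set {x // blk x = 2} × Set {x // blk x = 0} :=
  ({a | a.1 ∈ ω}, {b | b.1 ∈ ω}, {c | c.1 ∈ ω})

omit [Fintype κ] in
/-- Every configuration is glued from its block-traces. [this work] -/
theorem glue3_traces (ω : Set κ) : glue3 blk (traces blk ω) = ω := by
  ext x
  have h3 : blk x = 0 ∨ blk x = 1 ∨ blk x = 2 := by
    rcases blk x with ⟨i, hi⟩
    interval_cases i <;> simp
  rcases h3 with h | h | h
  · rw [mem_glue3_zero blk _ h]; rfl
  · rw [mem_glue3_one blk _ h]; rfl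
  · rw [mem_glue3_two blk _ h]; rfl

omit [Fintype κ] in
/-- The block-traces of a glued configuration. [this work] -/
theorem traces_glue3 (q : Set {x // blk x = 1} × Set {x // blk x = 2} × Set {x // blk x = 0}) : traces blk (glue3 blk q) = q := by
  ext a
  · show a.1 ∈ glue3 blk q ↔ a ∈ q.1
    rw [mem_glue3_one blk q a.2]
  · show a.1 ∈ glue3 blk q ↔ a ∈ q.2.1
    rw [mem_glue3_two blk q a.2]
  · show a.1 ∈ glue3 blk q ↔ a ∈ q.2.2
    rw [mem_glue3_zero blk q a.2]

omit [Fintype κ] in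
/-- `glue3` is injective. [this work] -/
theorem glue3_injective : Function.Injective (glue3 blk) := fun q q' h => by
  rw [← traces_glue3 blk q, ← traces_glue3 blk q', h]

omit [Fintype κ] in
/-- `glue3` is monotone in each block. [this work] -/
theorem glue3_mono {q q' : Set {x // blk x = 1} × Set {x // blk x = 2} × Set {x // blk x = 0}}
    (h1 : q.1 ⊆ q'.1) (h2 : q.2.1 ⊆ q'.2.1) (h3 : q.2.2 ⊆ q'.2.2) : glue3 blk q ⊆ glue3 blk q' := by
  rintro x (⟨h, hm⟩ | ⟨h, hm⟩ | ⟨h, hm⟩)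
  · exact Or.inl ⟨h, h1 hm⟩
  · exact Or.inr (Or.inl ⟨h, h2 hm⟩)
  · exact Or.inr (Or.inr ⟨h, h3 hm⟩)

/-! ### The product weight factors over the blocks -/

/-- **The product weight of a glued configuration is the product of the three block weights.** [folklore] -/
theorem weight_glue3 (w : κ → ℝ) (q : Set {x // blk x = 1} × Set {x // blk x = 2} × Set {x // blk x = 0}) :
    weight w (glue3 blk q) = weight (fun a : {x // blk x = 1} => w a.1) q.1 * weight (fun b : {x // blk x = 2} => w b.1) q.2.1 *
      weight (fun c : {x // blk x = 0} => w c.1) q.2.2 := by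
  unfold weight
  rw [← Fintype.prod_fiberwise blk (fun x => if x ∈ glue3 blk q then w x else 1 - w x), Fin.prod_univ_three]
  have e0 : (∏ c : {x // blk x = 0}, (if (c.1 : κ) ∈ glue3 blk q then w c.1 else 1 - w c.1)) =
      ∏ c : {x // blk x = 0}, (if c ∈ q.2.2 then w c.1 else 1 - w c.1) :=
    Finset.prod_congr rfl fun c _ => by rw [mem_glue3_zero blk q c.2]
  have e1 : (∏ a : {x // blk x = 1}, (if (a.1 : κ) ∈ glue3 blk q then w a.1 else 1 - w a.1)) =
      ∏ a : {x // blk x = 1}, (if a ∈ q.1 then w a.1 else 1 - w a.1) :=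
    Finset.prod_congr rfl fun a _ => by rw [mem_glue3_one blk q a.2]
  have e2 : (∏ b : {x // blk x = 2}, (if (b.1 : κ) ∈ glue3 blk q then w b.1 else 1 - w b.1)) =
      ∏ b : {x // blk x = 2}, (if b ∈ q.2.1 then w b.1 else 1 - w b.1) :=
    Finset.prod_congr rfl fun b _ => by rw [mem_glue3_two blk q b.2]
  rw [e0, e1, e2]
  ring

/-- **The product measure on `2^κ` is the push-forward along `glue3` of the product of the three block product measures.** [folklore] -/
theorem pushWeight_glue3 (p : κ → unitInterval) :
    pushWeight (fun q : Set {x // blk x = 1} × Set {x // blk x = 2} × Set {x // blk x = 0} =>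
        bernoulliWeight (fun a : {x // blk x = 1} => p a.1) q.1 * bernoulliWeight (fun b : {x // blk x = 2} => p b.1) q.2.1 *
          bernoulliWeight (fun c : {x // blk x = 0} => p c.1) q.2.2) (glue3 blk) =
      bernoulliWeight p := by
  funext ω
  rw [← glue3_traces blk ω, pushWeight_apply_of_injective _ (glue3_injective blk)]
  exact (weight_glue3 blk (fun x => (p x : ℝ)) (traces blk ω)).symm

/-! ### Events living on two blocks pull back to two-block functions -/

omit [Fintype κ] in
/-- An event unaffected by block `2` pulls back to a function of the blocks `(0, 1)` = `(c, a)`. [this work] -/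
theorem ind_glue3_of_determinedBy_ne_two {U : Set (Set κ)} (hU : DeterminedBy U {x | blk x ≠ 2})
    (q : Set {x // blk x = 1} × Set {x // blk x = 2} × Set {x // blk x = 0}) :
    ind U (glue3 blk q) = ind U (glue3 blk (q.1, ∅, q.2.2)) := by
  have key : glue3 blk q ∈ U ↔ glue3 blk (q.1, ∅, q.2.2) ∈ U := by
    refine (determinedBy_iff U _).1 hU _ _ ?_
    ext x
    simp only [Set.mem_inter_iff, Set.mem_setOf_eq, glue3]
    constructor
    · rintro ⟨h | ⟨h2, _⟩ | h, hx⟩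
      · exact ⟨Or.inl h, hx⟩
      · exact absurd h2 hx
      · exact ⟨Or.inr (Or.inr h), hx⟩
    · rintro ⟨h | ⟨h2, _⟩ | h, hx⟩
      · exact ⟨Or.inl h, hx⟩
      · exact absurd h2 hx
      · exact ⟨Or.inr (Or.inr h), hx⟩
  by_cases hm : glue3 blk q ∈ U
  · rw [ind_of_mem hm, ind_of_mem (key.1 hm)]
  · rw [ind_of_not_mem hm, ind_of_not_mem fun h' => hm (key.2 h')]

omit [Fintype κ] in
/-- An event unaffected by block `1` pulls back to a function of the blocks `(0, 2)` = `(c, b)`. [this work] -/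
theorem ind_glue3_of_determinedBy_ne_one {U : Set (Set κ)} (hU : DeterminedBy U {x | blk x ≠ 1})
    (q : Set {x // blk x = 1} × Set {x // blk x = 2} × Set {x // blk x = 0}) :
    ind U (glue3 blk q) = ind U (glue3 blk (∅, q.2.1, q.2.2)) := by
  have key : glue3 blk q ∈ U ↔ glue3 blk (∅, q.2.1, q.2.2) ∈ U := by
    refine (determinedBy_iff U _).1 hU _ _ ?_
    ext x
    simp only [Set.mem_inter_iff, Set.mem_setOf_eq, glue3]
    constructor
    · rintro ⟨⟨h1, _⟩ | h | h, hx⟩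
      · exact absurd h1 hx
      · exact ⟨Or.inr (Or.inl h), hx⟩
      · exact ⟨Or.inr (Or.inr h), hx⟩
    · rintro ⟨⟨h1, _⟩ | h | h, hx⟩
      · exact absurd h1 hx
      · exact ⟨Or.inr (Or.inl h), hx⟩
      · exact ⟨Or.inr (Or.inr h), hx⟩
  by_cases hm : glue3 blk q ∈ U
  · rw [ind_of_mem hm, ind_of_mem (key.1 hm)]
  · rw [ind_of_not_mem hm, ind_of_not_mem fun h' => hm (key.2 h')]

omit [Fintype κ] in
/-- An event unaffected by block `0` pulls back to a function of the blocks `(1, 2)` = `(a, b)`. [this work] -/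
theorem ind_glue3_of_determinedBy_ne_zero {U : Set (Set κ)} (hU : DeterminedBy U {x | blk x ≠ 0})
    (q : Set {x // blk x = 1} × Set {x // blk x = 2} × Set {x // blk x = 0}) :
    ind U (glue3 blk q) = ind U (glue3 blk (q.1, q.2.1, ∅)) := by
  have key : glue3 blk q ∈ U ↔ glue3 blk (q.1, q.2.1, ∅) ∈ U := by
    refine (determinedBy_iff U _).1 hU _ _ ?_
    ext x
    simp only [Set.mem_inter_iff, Set.mem_setOf_eq, glue3]
    constructor
    · rintro ⟨h | h | ⟨h0, _⟩, hx⟩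
      · exact ⟨Or.inl h, hx⟩
      · exact ⟨Or.inr (Or.inl h), hx⟩
      · exact absurd h0 hx
    · rintro ⟨h | h | ⟨h0, _⟩, hx⟩
      · exact ⟨Or.inl h, hx⟩
      · exact ⟨Or.inr (Or.inl h), hx⟩
      · exact absurd h0 hx
  by_cases hm : glue3 blk q ∈ U
  · rw [ind_of_mem hm, ind_of_mem (key.1 hm)]
  · rw [ind_of_not_mem hm, ind_of_not_mem fun h' => hm (key.2 h')]

/-! ### Class T on one cube: `C_3` and the λ = 2 rung from the three-block theorems -/

section ClassT

variable (U₀ U₁ U₂ : Set (Set κ))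

/-- **`E_3` of three events living on two blocks each is the three-block `E_3`** of `…SahiTriangleClassT` / `…SahiClassTLambdaTwoCubes`
(push-forward along `glue3`, `sahiE_pushWeight`). [this work] -/
theorem sahiE_three_ind_eq_blocks (p : κ → unitInterval)
    (h₀ : DeterminedBy U₀ {x | blk x ≠ 2}) (h₁ : DeterminedBy U₁ {x | blk x ≠ 1}) (h₂ : DeterminedBy U₂ {x | blk x ≠ 0}) :
    sahiE (bernoulliWeight p) 3 ![ind U₀, ind U₁, ind U₂] =
      sahiE (fun q : Set {x // blk x = 1} × Set {x // blk x = 2} × Set {x // blk x = 0} =>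
          bernoulliWeight (fun a : {x // blk x = 1} => p a.1) q.1 * bernoulliWeight (fun b : {x // blk x = 2} => p b.1) q.2.1 *
            bernoulliWeight (fun c : {x // blk x = 0} => p c.1) q.2.2) 3
        ![fun q => (fun (c : Set {x // blk x = 0}) (a : Set {x // blk x = 1}) => ind U₀ (glue3 blk (a, ∅, c))) q.2.2 q.1,
          fun q => (fun (c : Set {x // blk x = 0}) (b : Set {x // blk x = 2}) => ind U₁ (glue3 blk (∅, b, c))) q.2.2 q.2.1,
          fun q => (fun (a : Set {x // blk x = 1}) (b : Set {x // blk x = 2}) => ind U₂ (glue3 blk (a, b, ∅))) q.1 q.2.1] := by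
  rw [← pushWeight_glue3 blk p, sahiE_pushWeight]
  congr 1
  funext i q
  fin_cases i
  · show ind U₀ (glue3 blk q) = ind U₀ (glue3 blk (q.1, ∅, q.2.2))
    exact ind_glue3_of_determinedBy_ne_two blk h₀ q
  · show ind U₁ (glue3 blk q) = ind U₁ (glue3 blk (∅, q.2.1, q.2.2))
    exact ind_glue3_of_determinedBy_ne_one blk h₁ q
  · show ind U₂ (glue3 blk q) = ind U₂ (glue3 blk (q.1, q.2.1, ∅))
    exact ind_glue3_of_determinedBy_ne_zero blk h₂ q

variable {U₀ U₁ U₂}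

/-- **Sahi's `C_3` for three increasing events living on two blocks each** (block form of class T on one cube): `E_3(μ_p; 1_{U₀},1_{U₁},1_{U₂}) ≥ 0`
for every `p`, from `SahiTriangleClassT.sahiE_three_nonneg_cubes_triangle` (P2 gen 8). [this work] -/
theorem sahiE_three_nonneg_of_blocks (hU₀ : IsUpperSet U₀) (hU₁ : IsUpperSet U₁) (hU₂ : IsUpperSet U₂)
    (h₀ : DeterminedBy U₀ {x | blk x ≠ 2}) (h₁ : DeterminedBy U₁ {x | blk x ≠ 1}) (h₂ : DeterminedBy U₂ {x | blk x ≠ 0})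
    (p : κ → unitInterval) : 0 ≤ sahiE (bernoulliWeight p) 3 ![ind U₀, ind U₁, ind U₂] := by
  rw [sahiE_three_ind_eq_blocks blk U₀ U₁ U₂ p h₀ h₁ h₂]
  exact SahiTriangleClassT.sahiE_three_nonneg_cubes_triangle _ _ _ (fun c a => ind U₀ (glue3 blk (a, ∅, c)))
    (fun c b => ind U₁ (glue3 blk (∅, b, c))) (fun a b => ind U₂ (glue3 blk (a, b, ∅)))
    (fun c a => ind_nonneg _ _) (fun c a a' haa => monotone_ind_of_isUpperSet hU₀ (glue3_mono blk haa le_rfl le_rfl))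
    (fun a c c' hcc => monotone_ind_of_isUpperSet hU₀ (glue3_mono blk le_rfl le_rfl hcc))
    (fun c b => ind_nonneg _ _) (fun c b b' hbb => monotone_ind_of_isUpperSet hU₁ (glue3_mono blk le_rfl hbb le_rfl))
    (fun b c c' hcc => monotone_ind_of_isUpperSet hU₁ (glue3_mono blk le_rfl le_rfl hcc))
    (fun a b => ind_nonneg _ _) (fun b a a' haa => monotone_ind_of_isUpperSet hU₂ (glue3_mono blk haa le_rfl le_rfl))
    (fun a b b' hbb => monotone_ind_of_isUpperSet hU₂ (glue3_mono blk le_rfl hbb le_rfl))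

/-- **THEOREM (Sahi's `C_3` / Kahn's Conjecture 5 ON CLASS T, single-cube form).**  For increasing events `U₀, U₁, U₂ ⊆ 2^κ` such that NO
coordinate is essential to all three (`SahiHybrid.IsClassT (fun i => esupp (U i))`, stated here unfolded), `E_3(μ_p; 1_{U₀}, 1_{U₁}, 1_{U₂}) ≥ 0` for
EVERY product measure `μ_p`.  (P2 gen 8's triangle-class theorem `SahiTriangleClassT.sahiE_three_nonneg_cubes_triangle`, transported to one cube
with the blocks `C = esupp U₀ ∩ esupp U₁`, `A = esupp U₀ ∖ esupp U₁`, `B = (esupp U₀)ᶜ`.) [this work] -/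
theorem sahiE_three_nonneg_of_classT (hU₀ : IsUpperSet U₀) (hU₁ : IsUpperSet U₁) (hU₂ : IsUpperSet U₂)
    (hT : ∀ x, ¬ (x ∈ esupp U₀ ∧ x ∈ esupp U₁ ∧ x ∈ esupp U₂)) (p : κ → unitInterval) :
    0 ≤ sahiE (bernoulliWeight p) 3 ![ind U₀, ind U₁, ind U₂] := by
  let blk : κ → Fin 3 := fun x => if x ∈ esupp U₀ then (if x ∈ esupp U₁ then 0 else 1) else 2
  refine sahiE_three_nonneg_of_blocks blk hU₀ hU₁ hU₂ ?_ ?_ ?_ p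
  · refine (determinedBy_esupp hU₀).mono fun x hx => ?_
    have hx' : x ∈ esupp U₀ := hx
    simp only [Set.mem_setOf_eq, blk, hx', if_true]
    split_ifs <;> decide
  · refine (determinedBy_esupp hU₁).mono fun x hx => ?_
    have hx' : x ∈ esupp U₁ := hx
    simp only [Set.mem_setOf_eq, blk, hx', if_true]
    split_ifs <;> decide
  · refine (determinedBy_esupp hU₂).mono fun x hx => ?_
    have hx' : x ∈ esupp U₂ := hx
    simp only [Set.mem_setOf_eq, blk]
    by_cases h0 : x ∈ esupp U₀
    · by_cases h1 : x ∈ esupp U₁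
      · exact absurd ⟨h0, h1, hx'⟩ (hT x)
      · simp only [h0, h1, if_true, if_false]; decide
    · simp only [h0, if_false]; decide

/-- The same for a `Fin 3`-family of events. [this work] -/
theorem sahiE_three_nonneg_of_classT' (U : Fin 3 → Set (Set κ)) (hU : ∀ i, IsUpperSet (U i))
    (hT : ∀ x, ¬ (x ∈ esupp (U 0) ∧ x ∈ esupp (U 1) ∧ x ∈ esupp (U 2))) (p : κ → unitInterval) :
    0 ≤ sahiE (bernoulliWeight p) 3 (fun i => ind (U i)) := by
  have h : (fun i => ind (U i)) = ![ind (U 0), ind (U 1), ind (U 2)] := by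
    funext i; fin_cases i <;> rfl
  rw [h]
  exact sahiE_three_nonneg_of_classT (hU 0) (hU 1) (hU 2) hT p

end ClassT

end SahiClassTCube

end Summit.CriticalPhenomena.PercolationContinuityZ3.Theorems
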